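import Summits.QuantumFields.YangMills.Theorems.SwapVirialDeficitSectorLaplaceMbDensityPointwise
import Summits.QuantumFields.YangMills.Theorems.SwapVirialDeficitQuantitativeLaplaceDiagonalGaussianCeiling
import HarnessLib

/-!
# (S)-road, stub S4(i): THE ANISOTROPIC CEILING OF THE MORSE–BOTT DENSITY `𝔪(a,ε,p)` from a blockwise floor of the fibre form
# (free-hands support of ⟨stmt-QuantumFields-24197⟩ `SwapVirialDeficit.SwapGluedStiffness` ∕ ⟨24194⟩; model corollary of ✓`…QuantitativeLaplaceDiagonalGaussianCeiling`)

w3 g66's S4 analysis (STATUS 2026-08-31T18:01Z; LEAD 18:02Z): finiteness of the main constant `𝔐₀ = K_L·Σ∫∫𝔪` needs the fibre factor bounded with the SOFT modes at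
their own stiffness — `Q ≥ κ_x|u|² + κ_y|v|² + κ_z|z|² + κ_F Σ_f|η_f|²` ⟹ `𝔪 ≤ ρ(gnoBase p)·κ_x⁻¹κ_y⁻¹κ_z^{−3/2}κ_F^{−3|Fol L|/2}`.  This file is that implication in
fcl-p3 g47's letters (`fibQ`, `mbDensity` of ✓`SectorLaplaceDefs`; blocks `((u,v),z,η_F) = gnoFibreBlocks y` of ✓`BlowUpGnomonicFibreDefs`):

* `blockWeight_le` (a common floor `λ ≤ κ_•` transfers to the coordinatewise weight), `blockWeight_sum_eq` (`Σ_i κ_i y_i² = κ_x|u|² + κ_y|v|² + κ_z|z|² + κ_F Σ|η_f|²`),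
  `blockWeight_prod_eq` (`Π_i κ_i^{−1/2} = (κ_x^{−1/2})²(κ_y^{−1/2})²(κ_z^{−1/2})³(κ_F^{−1/2})^{3|Fol L|}`);
* ★★ `mbDensity_le_of_aniso_floor` — hub `a ≠ 0`, any signs and base point, weights `κ_x, κ_y, κ_z, κ_F ≥ λ > 0` with the blockwise floor on `fibQ a ε p` ⟹
  `mbDensity a ε p ≤ ρ(gnoBase p)·(κ_x^{−1/2})²·(κ_y^{−1/2})²·((κ_z^{−1/2})³·(κ_F^{−1/2})^{|Fol L|·3})`.

What is NOT here (w3 g66's lane): the blockwise ray floor itself at every hub (`κ_x = c·sin²2ψ/(2+x₀²)L⁻⁶`, …, from ✓`fibre_growth_gnomonic` block by block + the gauge lemma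
with the anisotropic gauge), the END commutator stiffness, and the cone integrability of `κ_x⁻¹κ_y⁻¹`.
HONEST LABEL: a corollary; ⟨24197⟩ ∕ ⟨24194⟩ (window-uniform) OPEN; own crux ⟨22884⟩ OPEN (blocked-on ⟨19935⟩); no crux, rung of record or summit is proved; the Yang–Mills
mass gap is NOT proved; no summit is proved by a line.  Width seat ym-line-sfw-p2-w2 g59 (cell ym-idea-1, free hands), `--supports stmt-QuantumFields-24197`.
THEOREMS ONLY (0 `def`, 0 `sorry`), standard axioms.  References: [cite: Breitung1994, Lemma 26 (2.102), p. 30]; [folklore].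
-/

set_option autoImplicit false
set_option synthInstance.maxSize 1024

noncomputable section

open MeasureTheory Quaternion Set Module
open scoped Quaternion BigOperators ENNReal InnerProductSpace
open Literature.MathematicalPhysics.QuantumLattice
open Literature.MathematicalPhysics.QuantumFieldTheory hiding SU2

namespace Summit.QuantumFields.YangMills.Theorems.SwapVirialDeficit.SectorLaplace

open Summit.QuantumFields.YangMills.Theorems.FemtoTransferGap
open Summit.QuantumFields.YangMills.Theorems.FemtoTransferGap.TT
open Summit.QuantumFields.YangMills.Theorems.VirialFluxGap.RingDeficit
open Summit.QuantumFields.YangMills.Theorems.SwapVirialDeficit.SwapRing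
open Summit.QuantumFields.YangMills.Theorems.SwapVirialDeficit.BlowUpRing
open Summit.QuantumFields.YangMills.Theorems.SwapVirialDeficit.Gnomonic (normSq3)
open Summit.QuantumFields.YangMills.Theorems.QuantitativeLaplace (normalised_integral_exp_neg_half_le_of_diag)

variable {L : ℕ} [NeZero L]

omit [NeZero L] in
/-- A common floor `λ ≤ κ_x, κ_y, κ_z, κ_F` is a floor of the coordinatewise block weight. [folklore] -/
theorem blockWeight_le {κx κy κz κF lam : ℝ} (hx : lam ≤ κx) (hy : lam ≤ κy) (hz : lam ≤ κz) (hF : lam ≤ κF) (i : GnoFibreIdx L) :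
    lam ≤ Sum.elim (Sum.elim (fun _ : Fin 2 => κx) (fun _ : Fin 2 => κy)) (Sum.elim (fun _ : Fin 3 => κz) (fun _ : Fol L × Fin 3 => κF)) i := by
  rcases i with ((j | j) | (k | fk))
  · exact hx
  · exact hy
  · exact hz
  · exact hF

/-- The coordinatewise block weight, summed against `y_i²`, is the blockwise quadratic form in w3's letters `((u,v),z,η_F) = gnoFibreBlocks y`. [folklore] -/
theorem blockWeight_sum_eq (κx κy κz κF : ℝ) (y : GnoFibre L) :
    ∑ i, Sum.elim (Sum.elim (fun _ : Fin 2 => κx) (fun _ : Fin 2 => κy)) (Sum.elim (fun _ : Fin 3 => κz) (fun _ : Fol L × Fin 3 => κF)) i * (y i) ^ 2 =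
      κx * ((gnoFibreBlocks y).1.1 0 ^ 2 + (gnoFibreBlocks y).1.1 1 ^ 2) + κy * ((gnoFibreBlocks y).1.2 0 ^ 2 + (gnoFibreBlocks y).1.2 1 ^ 2) +
        κz * normSq3 (gnoFibreBlocks y).2.1 + κF * ∑ f, normSq3 ((gnoFibreBlocks y).2.2 f) := by
  rw [Fintype.sum_sum_type, Fintype.sum_sum_type, Fintype.sum_sum_type, Fintype.sum_prod_type, Fin.sum_univ_two, Fin.sum_univ_two]
  simp only [Sum.elim_inl, Sum.elim_inr, gnoFibreBlocks, normSq3, Finset.mul_sum]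
  ring

/-- The coordinatewise block weight's `Π κ_i^{−1/2}` in block letters. [folklore] -/
theorem blockWeight_prod_eq (κx κy κz κF : ℝ) :
    ∏ i, (Sum.elim (Sum.elim (fun _ : Fin 2 => κx) (fun _ : Fin 2 => κy)) (Sum.elim (fun _ : Fin 3 => κz) (fun _ : Fol L × Fin 3 => κF)) i) ^ (-(1 / 2 : ℝ)) =
      (κx ^ (-(1 / 2 : ℝ))) ^ 2 * (κy ^ (-(1 / 2 : ℝ))) ^ 2 * ((κz ^ (-(1 / 2 : ℝ))) ^ 3 * (κF ^ (-(1 / 2 : ℝ))) ^ (Fintype.card (Fol L) * 3)) := by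
  rw [Fintype.prod_sum_type, Fintype.prod_sum_type, Fintype.prod_sum_type]
  simp only [Sum.elim_inl, Sum.elim_inr, Finset.prod_const, Finset.card_univ, Fintype.card_fin, Fintype.card_prod]

/-- ★★ **THE ANISOTROPIC CEILING OF THE MORSE–BOTT DENSITY**: hub `a ≠ 0`, any signs `ε` and base point `p`; if the fibre form is bounded below BLOCKWISE,
`κ_x|u|² + κ_y|v|² + κ_z|z|² + κ_F Σ_f|η_f|² ≤ Q_{a,ε,p}(y)` for all `y` (`((u,v),z,η_F) = gnoFibreBlocks y`), with a common floor `0 < λ ≤ κ_•`, then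
`𝔪(a,ε,p) ≤ ρ(gnoBase p)·(κ_x^{−1/2})²(κ_y^{−1/2})²((κ_z^{−1/2})³(κ_F^{−1/2})^{|Fol L|·3})` — the soft leader-transverse modes cost only `κ_x⁻¹κ_y⁻¹`.
[cite: Breitung1994, Lemma 26 (2.102), p. 30] -/
theorem mbDensity_le_of_aniso_floor {a : ℍ} (ha : a ≠ 0) (ε : GnoSign L) (p : ℝ × ℝ) {κx κy κz κF lam : ℝ} (hlam : 0 < lam)
    (hx : lam ≤ κx) (hy : lam ≤ κy) (hz : lam ≤ κz) (hF : lam ≤ κF)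
    (hQ : ∀ y : GnoFibre L, κx * ((gnoFibreBlocks y).1.1 0 ^ 2 + (gnoFibreBlocks y).1.1 1 ^ 2) + κy * ((gnoFibreBlocks y).1.2 0 ^ 2 + (gnoFibreBlocks y).1.2 1 ^ 2) +
        κz * normSq3 (gnoFibreBlocks y).2.1 + κF * ∑ f, normSq3 ((gnoFibreBlocks y).2.2 f) ≤ fibQ a ε p y) :
    mbDensity (L := L) a ε p ≤
      gnoDensity (gnoBase p.1 p.2 : GnoCoord L) * ((κx ^ (-(1 / 2 : ℝ))) ^ 2 * (κy ^ (-(1 / 2 : ℝ))) ^ 2 * ((κz ^ (-(1 / 2 : ℝ))) ^ 3 * (κF ^ (-(1 / 2 : ℝ))) ^ (Fintype.card (Fol L) * 3))) := by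
  have hκlam := blockWeight_le (L := L) hx hy hz hF
  have hQ' : ∀ y : GnoFibre L,
      ∑ i, Sum.elim (Sum.elim (fun _ : Fin 2 => κx) (fun _ : Fin 2 => κy)) (Sum.elim (fun _ : Fin 3 => κz) (fun _ : Fol L × Fin 3 => κF)) i * (y i) ^ 2 ≤ fibQ a ε p y :=
    fun y => by rw [blockWeight_sum_eq]; exact hQ y
  have h := normalised_integral_exp_neg_half_le_of_diag (measurable_fibQ ha ε p) hlam hκlam hQ'
  rw [blockWeight_prod_eq] at h
  unfold mbDensity alpha
  rw [mul_assoc]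
  exact mul_le_mul_of_nonneg_left h (gnoDensity_pos _).le

end Summit.QuantumFields.YangMills.Theorems.SwapVirialDeficit.SectorLaplace

end
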